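import Mathlib
import HarnessLib
import Literature.Computability.AlgebraicComplexity.PatternExpressions
import Literature.Computability.AlgebraicComplexity.DiPatternExpressions
import Literature.Combinatorics.SimpleGraph.TreeDecomposition
import Summits.ValiantsHypothesis.ValiantsHypothesis.Theorems.MonotoneRestorationOrbitRestorationQPHomSpan
import Summits.ValiantsHypothesis.ValiantsHypothesis.Theorems.MonotoneRestorationOrbitRestorationLinearVolumeQPHomPolyBasics
import Summits.ValiantsHypothesis.ValiantsHypothesis.Theorems.MonotoneRestorationOrbitRestorationLinearVolumeQPSubThresholdDescentExchange

/-!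
# Route MonotoneRestoration — aside `OrbitRestorationLinearVolumeQP` (stmt-ValiantsHypothesis-18294):
# SUB-THRESHOLD DESCENT, part 3/3 — ONE-SORTED NARROW + MATRIX-SYMMETRIC ⟹ BIPARTITELY NARROW, SAME WIDTH,
# for polynomials of degree `≤ n/2`

The registered skeleton of R1 (line `birth`, `0500973389fe`) rests on `stub_lvNarrowSpan` — membership of every level of a
`VP ∩ LV` family in the span of the homomorphism polynomials of BIPARTITE patterns of treewidth `≤ (log₂ n + c)^c` — whereas
the crux itself is EQUIVALENT to one-sorted narrowness (`OrbitRestorationLinearVolumeQPDiNarrow.orbitRestorationLinearVolumeQP_iff_lvDiNarrow`),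
and `LvNarrowSpan ⟹ LvDiNarrow` (`…NarrowSpanToDiNarrow`).  The converse — DESCENT: is a matrix-symmetric polynomial with a
narrow ONE-SORTED expansion narrow BIPARTITELY? — was the open, VH-free residue between the line and the crux (tree:
`…OrbitCompressionQPTwoSortedPassageSparse.lean` "stays OPEN"; `…DiHomIndependent.lean` landed "ingredient (i) of the
low-degree case"; item evidence `R1-DESCENT-g1.md`: exact finite data, on-the-nose failure only at `(n, d) = (4, 4)`).

THIS FILE SETTLES DESCENT BELOW THE INJECTIVE THRESHOLD, WITH NO LOSS:

* `descent_of_matrixSymmetric` — a matrix-symmetric `p` with `2 · deg p ≤ n` that is a combination of one-sorted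
  homomorphism polynomials of patterns of treewidth `≤ w` on `≤ n` vertices without isolated vertices lies in the span of the
  bipartite homomorphism polynomials of patterns of treewidth `≤ w` (the bipartite expansion of
  `HomSpan.mem_span_homPoly_of_matrixSymmetric`, isolated vertices erased, fed to `descent_of_expansions`);
* `subThreshold_descent` — **SPAN FORM: for matrix-symmetric `p` with `2 · deg p ≤ n`, membership in the ONE-SORTED narrow
  span of width `w` (patterns of any order, any number of terms) implies membership in the BIPARTITE narrow span of the SAME
  width `w`** (high-degree terms cancel by homogeneity; the surviving patterns have `≤ deg p` edges hence `≤ n` non-isolated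
  vertices);
* `narrowSpan_le_diNarrowSpan`, `mem_diNarrowSpan_iff_mem_narrowSpan` — with the easy converse: an `iff`;
* `halfDegree_narrowSpan_iff_diNarrowSpan` — the statement in the item's currency: on the half-degree levels
  (`2 · deg f_n ≤ n`) of any matrix-symmetric family, the conclusion of `stub_lvNarrowSpan` at width `(log₂ n + c)^c` is
  EQUIVALENT to one-sorted span-narrowness of the same width.

CONSEQUENCE FOR THE ITEM (honest label): every possible gap between the registered line `birth` and the crux R1 — every
failure of descent — lives in degrees `> n/2`, i.e. in the oversized-pattern regime of the linear-volume class (patterns with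
more than `n` non-isolated vertices, where one-sorted folding relations exist that bipartite folding lacks; the `(4,4)`
example of the evidence memo is of this kind).  What remains between `LvDiNarrow` and `LvNarrowSpan` is (a) descent in
degrees `> n/2` with polylogarithmic loss and (b) the expression → span unfolding for one-sorted `k`-label expressions; the
stub itself (Dwivedi–Pago–Seppelt Outlook Q3 at qp scale), R1 and VP ≠ VNP are NOT moved.  Def-free helper
(`--supports stmt-ValiantsHypothesis-18294`); nothing here is a named fact.

References: Dawar–Pago–Seppelt 2025 (arXiv:2502.06740) Thm 1.1, Remark p. 17, §7 p. 45; Dwivedi–Pago–Seppelt 2026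
(arXiv:2601.09343) eq. (1), Lemma 8.18, Outlook Q3.
-/

noncomputable section

open scoped Classical

-- `Summit.ValiantsHypothesis.ValiantsHypothesis.…` is the tree's single-conjunct layout (Sub = Summit).
set_option linter.dupNamespace false

namespace Summit.ValiantsHypothesis.ValiantsHypothesis.Theorems.SubThresholdDescent

open Literature.Computability.AlgebraicComplexity MvPolynomial
open Literature.Combinatorics.SimpleGraph (treewidth treewidth_le_of_hom_injective)
open Summit.ValiantsHypothesis.ValiantsHypothesis.Theorems

/-! ### Descent for matrix-symmetric polynomials below the injective threshold -/

/-- **DESCENT FOR MATRIX-SYMMETRIC POLYNOMIALS, CLEAN FORM.**  A MATRIX-symmetric polynomial `p` of degree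
`≤ n/2` that is a combination of one-sorted homomorphism polynomials of patterns of treewidth `≤ w` on `≤ n`
vertices without isolated vertices lies in the span of the BIPARTITE homomorphism polynomials of patterns
of treewidth `≤ w` (same width).  The bipartite expansion fed to `descent_of_expansions` is the one every
matrix-symmetric polynomial has (`HomSpan.mem_span_homPoly_of_matrixSymmetric`: patterns with `≤ deg p`
rows, columns and edges), with isolated vertices erased (`homPoly_map_subtype`), so that its patterns have
`≤ 2 deg p ≤ n` vertices. [folklore] -/
theorem descent_of_matrixSymmetric (n w : ℕ) (p : MvPolynomial (Fin n × Fin n) ℂ)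
    (hp : ∀ σ τ : Equiv.Perm (Fin n), rename (fun ij : Fin n × Fin n => (σ ij.1, τ ij.2)) p = p)
    (hdeg : 2 * p.totalDegree ≤ n)
    {ι₁ : Type} [Fintype ι₁] [DecidableEq ι₁] (a : ι₁ → ℕ)
    (D : (i : ι₁) → Multiset (Fin (a i) × Fin (a i))) (α : ι₁ → ℂ)
    (ha : ∀ i, a i ≤ n) (hDvert : ∀ i (u : Fin (a i)), ∃ e ∈ D i, e.1 = u ∨ e.2 = u)
    (hDtw : ∀ i,
      treewidth (SimpleGraph.fromRel fun u v : Fin (a i) => ∃ e ∈ D i, u = e.1 ∧ v = e.2) ≤ w)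
    (hpD : p = ∑ i, α i • diHomPoly (D i) n ℂ) :
    p ∈ Submodule.span ℂ {q : MvPolynomial (Fin n × Fin n) ℂ | ∃ (a b : ℕ) (F : Multiset (Fin a × Fin b)),
      treewidth (SimpleGraph.fromRel fun u v : Fin a ⊕ Fin b =>
          ∃ e ∈ F, u = Sum.inl e.1 ∧ v = Sum.inr e.2) ≤ w ∧
        q = homPoly F n ℂ} := by
  -- the bipartite expansion of a matrix-symmetric polynomial
  obtain ⟨m, γ, q, hq⟩ := (Submodule.mem_span_set').1 (HomSpan.mem_span_homPoly_of_matrixSymmetric p hp)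
  choose a₂ b₂ F ha₂ hb₂ hF hqF using fun j => (q j).2
  -- erase isolated vertices and transport to `Fin`
  choose F' hF'map hF'row hF'col hF'card using fun j => exists_eraseIsolated₂ (F j)
  let r : Fin m → ℕ := fun j => Fintype.card {i // ∃ e ∈ F j, e.1 = i}
  let c : Fin m → ℕ := fun j => Fintype.card {i // ∃ e ∈ F j, e.2 = i}
  let F'' : (j : Fin m) → Multiset (Fin (r j) × Fin (c j)) := fun j =>
    (F' j).map fun e => (Fintype.equivFin _ e.1, Fintype.equivFin _ e.2)
  have hF''poly : ∀ j, ∃ N : ℕ, homPoly (F j) n ℂ = N • homPoly (F'' j) n ℂ := by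
    intro j
    refine ⟨n ^ Fintype.card {i // ¬ ∃ e ∈ F j, e.1 = i} * n ^ Fintype.card {i // ¬ ∃ e ∈ F j, e.2 = i},
      ?_⟩
    rw [show homPoly (F'' j) n ℂ = homPoly (F' j) n ℂ from HomPolyBasics.homPoly_map_equiv _ _ _ _,
      ← homPoly_map_subtype, hF'map]
  choose N hN using hF''poly
  refine descent_of_expansions n w p a D α ha hDvert hDtw hpD r c F'' (fun j => γ j * (N j : ℂ))
    ?_ ?_ ?_ ?_
  · intro j
    have h1 : r j ≤ Multiset.card (F j) := card_nonIsolated_rows_le (F j)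
    have h2 : c j ≤ Multiset.card (F j) := card_nonIsolated_cols_le (F j)
    have h3 := hF j
    omega
  · intro j u
    obtain ⟨e, he, hu⟩ := hF'row j ((Fintype.equivFin _).symm u)
    exact ⟨_, Multiset.mem_map_of_mem _ he, by simp [hu]⟩
  · intro j v
    obtain ⟨e, he, hv⟩ := hF'col j ((Fintype.equivFin _).symm v)
    exact ⟨_, Multiset.mem_map_of_mem _ he, by simp [hv]⟩
  · rw [← hq]
    refine Finset.sum_congr rfl fun j _ => ?_
    rw [hqF j, hN j, mul_smul, Nat.cast_smul_eq_nsmul]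

/-- **SUB-THRESHOLD DESCENT (span form).**  Let `p` be a MATRIX-symmetric polynomial on the `n × n` matrix
with `2 · deg p ≤ n`.  If `p` lies in the span of the ONE-SORTED homomorphism polynomials `dihom_{D,n}` of
directed looped patterns of treewidth `≤ w` (any number of vertices, any number of terms), then `p` lies in
the span of the BIPARTITE homomorphism polynomials `hom_{F,n}` of patterns of treewidth `≤ w` — NO LOSS in
the width.  (Terms of degree `> deg p` cancel by homogeneity and are dropped; the surviving patterns have
`≤ deg p` edges, hence `≤ 2 deg p ≤ n` non-isolated vertices; erase the isolated ones and apply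
`descent_of_matrixSymmetric`.)  So the one-sorted → two-sorted passage left open in
`Theorems/…OrbitCompressionQPTwoSortedPassage{,Sparse}.lean` and `…LinearVolumeQPNarrowSpanToDiNarrow.lean`
holds ON THE NOSE below the injective threshold; every failure of descent (e.g. the `(n, d) = (4, 4)`
boundary example of the item's evidence memo) lives in degrees `> n/2`. [folklore] -/
theorem subThreshold_descent (n w : ℕ) (p : MvPolynomial (Fin n × Fin n) ℂ)
    (hp : ∀ σ τ : Equiv.Perm (Fin n), rename (fun ij : Fin n × Fin n => (σ ij.1, τ ij.2)) p = p)
    (hdeg : 2 * p.totalDegree ≤ n)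
    (hmem : p ∈ Submodule.span ℂ {q : MvPolynomial (Fin n × Fin n) ℂ |
      ∃ (a : ℕ) (D : Multiset (Fin a × Fin a)),
        treewidth (SimpleGraph.fromRel fun u v : Fin a => ∃ e ∈ D, u = e.1 ∧ v = e.2) ≤ w ∧
          q = diHomPoly D n ℂ}) :
    p ∈ Submodule.span ℂ {q : MvPolynomial (Fin n × Fin n) ℂ | ∃ (a b : ℕ) (F : Multiset (Fin a × Fin b)),
      treewidth (SimpleGraph.fromRel fun u v : Fin a ⊕ Fin b =>
          ∃ e ∈ F, u = Sum.inl e.1 ∧ v = Sum.inr e.2) ≤ w ∧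
        q = homPoly F n ℂ} := by
  obtain ⟨m, α, q, hq⟩ := (Submodule.mem_span_set').1 hmem
  choose a D hDtw hqD using fun i => (q i).2
  set d := p.totalDegree with hd
  -- truncation: only the patterns with `≤ d` edges matter
  have htrunc : p = ∑ i : {i : Fin m // Multiset.card (D i) ≤ d}, α i • diHomPoly (D i) n ℂ := by
    have hcomp : ∀ k, homogeneousComponent k p =
        ∑ i, α i • (if Multiset.card (D i) = k then diHomPoly (D i) n ℂ else 0) := by
      intro k
      rw [← hq, map_sum]
      refine Finset.sum_congr rfl fun i _ => ?_
      rw [map_smul, hqD i, homogeneousComponent_of_mem (isHomogeneous_diHomPoly (D i) n)]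
      by_cases hk : Multiset.card (D i) = k
      · rw [if_pos hk, if_pos hk.symm]
      · rw [if_neg hk, if_neg (Ne.symm hk)]
    calc p = ∑ k ∈ Finset.range (d + 1), homogeneousComponent k p := (sum_homogeneousComponent p).symm
      _ = ∑ i, α i • ∑ k ∈ Finset.range (d + 1),
            (if Multiset.card (D i) = k then diHomPoly (D i) n ℂ else 0) := by
          simp_rw [hcomp, Finset.smul_sum]; exact Finset.sum_comm
      _ = ∑ i, (if Multiset.card (D i) ≤ d then α i • diHomPoly (D i) n ℂ else 0) := by
          refine Finset.sum_congr rfl fun i _ => ?_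
          rw [Finset.sum_ite_eq]
          by_cases h : Multiset.card (D i) ≤ d
          · rw [if_pos (Finset.mem_range.2 (Nat.lt_succ_of_le h)), if_pos h]
          · rw [if_neg (fun h' => h (Nat.lt_succ_iff.1 (Finset.mem_range.1 h'))), if_neg h, smul_zero]
      _ = ∑ i : {i : Fin m // Multiset.card (D i) ≤ d}, α i • diHomPoly (D i) n ℂ := by
          rw [← Finset.sum_filter]
          exact Finset.sum_subtype _ (fun i => by simp) (fun i => α i • diHomPoly (D i) n ℂ)
  -- erase isolated vertices and transport to `Fin`
  choose D' hD'map hD'vert hD'card using fun i => exists_eraseIsolated (D i)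
  let cV : Fin m → ℕ := fun i => Fintype.card {v // ∃ e ∈ D i, e.1 = v ∨ e.2 = v}
  let D'' : (i : Fin m) → Multiset (Fin (cV i) × Fin (cV i)) := fun i =>
    (D' i).map fun e => (Fintype.equivFin _ e.1, Fintype.equivFin _ e.2)
  have hD''poly : ∀ i, ∃ N : ℕ, diHomPoly (D i) n ℂ = N • diHomPoly (D'' i) n ℂ := by
    intro i
    refine ⟨n ^ Fintype.card {v // ¬ ∃ e ∈ D i, e.1 = v ∨ e.2 = v}, ?_⟩
    rw [show diHomPoly (D'' i) n ℂ = diHomPoly (D' i) n ℂ from diHomPoly_map_equiv _ _ _,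
      ← diHomPoly_map_subtype, hD'map]
  choose N hN using hD''poly
  have hD''tw : ∀ i, treewidth (SimpleGraph.fromRel fun u v : Fin (cV i) =>
      ∃ e ∈ D'' i, u = e.1 ∧ v = e.2) ≤ w := by
    intro i
    rw [show D'' i = (D' i).map (fun e => (Fintype.equivFin _ e.1, Fintype.equivFin _ e.2)) from rfl,
      treewidth_map_equiv]
    refine le_trans ?_ (hDtw i)
    have h := treewidth_le_of_map_injective (D' i) Subtype.val Subtype.val_injective
    rwa [hD'map i] at h
  have hD''vert : ∀ i (u : Fin (cV i)), ∃ e ∈ D'' i, e.1 = u ∨ e.2 = u := by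
    intro i u
    obtain ⟨e, he, hu⟩ := hD'vert i ((Fintype.equivFin _).symm u)
    refine ⟨_, Multiset.mem_map_of_mem _ he, ?_⟩
    rcases hu with hu | hu
    · exact Or.inl (by simp [hu])
    · exact Or.inr (by simp [hu])
  refine descent_of_matrixSymmetric n w p hp hdeg (fun i : {i : Fin m // Multiset.card (D i) ≤ d} => cV i)
    (fun i => D'' i) (fun i => α i * (N i : ℂ)) (fun i => ?_) (fun i => hD''vert i) (fun i => hD''tw i) ?_
  · have h1 : cV i ≤ 2 * Multiset.card (D i) := card_nonIsolated_le (D i)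
    have h2 := i.2
    omega
  · rw [htrunc]
    refine Finset.sum_congr rfl fun i _ => ?_
    rw [hN i, mul_smul, Nat.cast_smul_eq_nsmul]

/-- The bipartite narrow span sits inside the one-sorted narrow span of the same width (orient the
patterns; `diHomPoly_orientFin`, `treewidth_orientFin`) — the easy direction, no hypotheses. [folklore] -/
theorem narrowSpan_le_diNarrowSpan (n w : ℕ) :
    Submodule.span ℂ {q : MvPolynomial (Fin n × Fin n) ℂ | ∃ (a b : ℕ) (F : Multiset (Fin a × Fin b)),
      treewidth (SimpleGraph.fromRel fun u v : Fin a ⊕ Fin b =>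
          ∃ e ∈ F, u = Sum.inl e.1 ∧ v = Sum.inr e.2) ≤ w ∧
        q = homPoly F n ℂ} ≤
    Submodule.span ℂ {q : MvPolynomial (Fin n × Fin n) ℂ |
      ∃ (a : ℕ) (D : Multiset (Fin a × Fin a)),
        treewidth (SimpleGraph.fromRel fun u v : Fin a => ∃ e ∈ D, u = e.1 ∧ v = e.2) ≤ w ∧
          q = diHomPoly D n ℂ} := by
  refine Submodule.span_le.2 ?_
  rintro q ⟨a, b, F, hF, rfl⟩
  refine Submodule.subset_span ⟨a + b, _, ?_, (diHomPoly_orientFin F n).symm⟩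
  rwa [treewidth_orientFin]

/-- **SUB-THRESHOLD DESCENT, `iff` form.**  For a matrix-symmetric polynomial of degree `≤ n/2`, lying in
the ONE-SORTED narrow span of width `w` and lying in the BIPARTITE narrow span of width `w` are the same
thing. [folklore] -/
theorem mem_diNarrowSpan_iff_mem_narrowSpan (n w : ℕ) (p : MvPolynomial (Fin n × Fin n) ℂ)
    (hp : ∀ σ τ : Equiv.Perm (Fin n), rename (fun ij : Fin n × Fin n => (σ ij.1, τ ij.2)) p = p)
    (hdeg : 2 * p.totalDegree ≤ n) :
    p ∈ Submodule.span ℂ {q : MvPolynomial (Fin n × Fin n) ℂ |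
      ∃ (a : ℕ) (D : Multiset (Fin a × Fin a)),
        treewidth (SimpleGraph.fromRel fun u v : Fin a => ∃ e ∈ D, u = e.1 ∧ v = e.2) ≤ w ∧
          q = diHomPoly D n ℂ} ↔
    p ∈ Submodule.span ℂ {q : MvPolynomial (Fin n × Fin n) ℂ | ∃ (a b : ℕ) (F : Multiset (Fin a × Fin b)),
      treewidth (SimpleGraph.fromRel fun u v : Fin a ⊕ Fin b =>
          ∃ e ∈ F, u = Sum.inl e.1 ∧ v = Sum.inr e.2) ≤ w ∧
        q = homPoly F n ℂ} :=
  ⟨subThreshold_descent n w p hp hdeg, fun h => narrowSpan_le_diNarrowSpan n w h⟩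

/-! ### The statement in the currency of the item -/

/-- **For aside `OrbitRestorationLinearVolumeQP` (stmt-ValiantsHypothesis-18294) and its registered stub
`stub_lvNarrowSpan`.**  On the HALF-DEGREE part of any class of matrix-symmetric families (levels with
`2 · deg f_n ≤ n`), the registered stub's conclusion — membership of `f n` in the span of the homomorphism
polynomials of BIPARTITE patterns of treewidth `≤ (log₂ n + c)^c` — is EQUIVALENT to membership in the
span of the ONE-SORTED homomorphism polynomials of directed looped patterns of the same treewidth bound
(the currency in which square-symmetric circuits live, Dawar–Pago–Seppelt).  So the possible gap between
line `birth` (`LvNarrowSpan ⟹ LvDiNarrow ⟺ R1`, `…NarrowSpanToDiNarrow`, `…DiNarrowTight`) and the crux is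
confined to degrees `> n/2` — the oversized-pattern regime of the linear-volume class.  Honest label:
structural (VH-free) helper; the stub, R1 and VP ≠ VNP are NOT moved.
[cite: DawarPagoSeppelt2025, Remark p. 17 and §7 p. 45; DwivediPagoSeppelt2026, Outlook Q3] -/
theorem halfDegree_narrowSpan_iff_diNarrowSpan (f : (n : ℕ) → MvPolynomial (Fin n × Fin n) ℂ) (c : ℕ)
    (hsymm : ∀ (n : ℕ) (σ τ : Equiv.Perm (Fin n)),
      rename (fun ij : Fin n × Fin n => (σ ij.1, τ ij.2)) (f n) = f n)
    (n : ℕ) (hdeg : 2 * (f n).totalDegree ≤ n) :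
    f n ∈ Submodule.span ℂ {p : MvPolynomial (Fin n × Fin n) ℂ | ∃ (a b : ℕ) (E : Multiset (Fin a × Fin b)),
      Literature.Combinatorics.SimpleGraph.treewidth
          (SimpleGraph.fromRel fun u v : Fin a ⊕ Fin b =>
            ∃ e ∈ E, u = Sum.inl e.1 ∧ v = Sum.inr e.2) ≤ (Nat.log 2 n + c) ^ c ∧
        p = homPoly E n ℂ} ↔
    f n ∈ Submodule.span ℂ {p : MvPolynomial (Fin n × Fin n) ℂ | ∃ (a : ℕ) (D : Multiset (Fin a × Fin a)),
      Literature.Combinatorics.SimpleGraph.treewidth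
          (SimpleGraph.fromRel fun u v : Fin a => ∃ e ∈ D, u = e.1 ∧ v = e.2) ≤ (Nat.log 2 n + c) ^ c ∧
        p = diHomPoly D n ℂ} :=
  (mem_diNarrowSpan_iff_mem_narrowSpan n ((Nat.log 2 n + c) ^ c) (f n) (hsymm n) hdeg).symm

end Summit.ValiantsHypothesis.ValiantsHypothesis.Theorems.SubThresholdDescent

end
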